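import Literature.Analysis.FluidPDE.KwonDriftTimeDerivative
import HarnessLib

/-!
# Kwon's drift: the weak time derivative of `t ↦ ⟪h(t,x), c⟫` ((T1), second step)

Analysis/FluidPDE proof file (theorems only) on the discharge path of the named fact
`Literature.Analysis.FluidPDE.kwon2023_velocity_epsilon_regularity`
(`PressureFreeEpsilonRegularity.lean`; H. Kwon, J. Differential Equations (2023) =
arXiv:2104.03160, Thm. 1.4). Continuing `KwonDriftTimeDerivative`: for a distributional solution
`(u, p)` of Navier–Stokes on `Q₂(0)` and its good representative `W` (`W = u` a.e. on `Q₂(0)`),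
the drift `h = driftField W` (`h(t,·) = H(W(t,·))`, Remark 2.3) satisfies, for every `x`, `c` and
every `χ ∈ C_c^∞((−4,0))`,

  `∫ χ'(s) ⟪h(s,x), c⟫ ds = − ∫ χ(s) (∫ (⟪W,(W·∇)η_{x,c}⟫ + ⟪W, Δη_{x,c}⟫ + p div η_{x,c})(s,y) dy) ds`

(`Kwon2023.integral_deriv_mul_inner_driftField_eq`), i.e. `t ↦ ⟪h(t,x),c⟫` has the weak derivative
`g_{x,c}(t) = ∫ (⟪W ⊗ W, ∇η⟫ + ⟪W, Δη⟫ + p div η)(t,y) dy` on `(−4,0)` — the time-regularity of the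
drift used in the proof of Lemma 2.5 (p. 8–9: "`h` is smooth in `x` and its time derivative is
controlled through the equation"). Steps: the momentum equation tested with `χ(s)η_{x,c}(y)`
(`ns_tested_time_smul_adjointField`) is transported from `u` to `W`, written over `ℝ × ℝ³` and
split by Fubini; the slice identity `⟪h(s,x),c⟫ = ∫⟪W(s,·), η_{x,c}⟫` (`inner_harmonicPart_eq_integral`)
identifies the `χ'`-term. No NS-regularity statement is touched.

## Mathlib / tree search

Tree (reused): `ns_tested_time_smul_adjointField`, `isSpaceTimeTestOn_time_smul_adjointField`,
`inner_harmonicPart_eq_integral` (`KwonDriftTimeDerivative`); `IsGoodVelocity` and its local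
integrability (`KwonSpaceTimeFields`, `KwonDecompositionMomentum`);
`integrable_inner_of_locallyIntegrableOn`, `integrable_mul_of_locallyIntegrableOn`
(`SuitableWeakPressure`); `contDiff_gradient_of_contDiff_top`, `contDiff_divergence_of_contDiff_top`
(`ClassicalLerayProjection`). Mathlib: `integral_prod`, `Integrable.prod_right_ae`,
`laplacian_congr_nhds`, `Filter.EventuallyEq.fderiv_eq`, `support_deriv_subset`,
`setIntegral_congr_ae`, `setIntegral_eq_integral_of_forall_compl_eq_zero`.

## References

* H. Kwon, *The role of the pressure in the regularity theory for the Navier–Stokes equations*,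
  J. Differential Equations 357 (2023) = arXiv:2104.03160: Remark 2.3 (2.3) and Lemma 2.5 (proof,
  p. 8–9). [Kwon2023RolePressure]
-/

noncomputable section

open MeasureTheory Set Function Filter Topology TopologicalSpace Metric InnerProductSpace
  ContinuousLinearMap
open scoped NNReal ENNReal RealInnerProductSpace Convolution ContDiff Laplacian

namespace Literature.Analysis.FluidPDE

namespace Kwon2023

variable {u W : ℝ → EuclideanSpace ℝ (Fin 3) → EuclideanSpace ℝ (Fin 3)} {p : ℝ → EuclideanSpace ℝ (Fin 3) → ℝ}

/-! ### The adjoint field: smoothness and the support of its derivatives -/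

/-- The adjoint field is smooth. [folklore] -/
private theorem contDiff_adjointField' (x c : EuclideanSpace ℝ (Fin 3)) :
    ContDiff ℝ ∞ fun y : EuclideanSpace ℝ (Fin 3) =>
      ⟪gradient annularKernel (x - y), c⟫ • gradient kwonCutoff y -
        cross (cross c (gradient annularKernel (x - y))) (gradient kwonCutoff y) := by
  have ha : ContDiff ℝ ∞ fun y : EuclideanSpace ℝ (Fin 3) => gradient annularKernel (x - y) :=
    (contDiff_gradient_of_contDiff_top contDiff_annularKernel).comp (contDiff_const.sub contDiff_id)
  have hg : ContDiff ℝ ∞ (gradient kwonCutoff) := contDiff_gradient_of_contDiff_top contDiff_kwonCutoff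
  have h1 : ContDiff ℝ ∞ fun y : EuclideanSpace ℝ (Fin 3) => cross c (gradient annularKernel (x - y)) := by
    have e : (fun y : EuclideanSpace ℝ (Fin 3) => cross c (gradient annularKernel (x - y))) =
        fun y => crossCLM c (gradient annularKernel (x - y)) := by
      funext y; rw [crossCLM_apply]
    rw [e]; exact (crossCLM c).contDiff.comp ha
  have h2 : ContDiff ℝ ∞ fun y : EuclideanSpace ℝ (Fin 3) =>
      cross (cross c (gradient annularKernel (x - y))) (gradient kwonCutoff y) := by
    have e : (fun y : EuclideanSpace ℝ (Fin 3) =>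
        cross (cross c (gradient annularKernel (x - y))) (gradient kwonCutoff y)) =
        fun y => crossCLM (cross c (gradient annularKernel (x - y))) (gradient kwonCutoff y) := by
      funext y; rw [crossCLM_apply]
    rw [e]; exact crossCLM.isBoundedBilinearMap.contDiff.comp (h1.prodMk hg)
  exact ((ha.inner ℝ contDiff_const).smul hg).sub h2

/-- The adjoint field vanishes near every point with `|y| > 7/4`. [folklore] -/
private theorem adjointField_eventuallyEq_zero {x c y : EuclideanSpace ℝ (Fin 3)} (hy : 7 / 4 < ‖y‖) :
    (fun y : EuclideanSpace ℝ (Fin 3) =>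
      ⟪gradient annularKernel (x - y), c⟫ • gradient kwonCutoff y -
        cross (cross c (gradient annularKernel (x - y))) (gradient kwonCutoff y)) =ᶠ[𝓝 y]
      fun _ => 0 := by
  have ho : IsOpen {w : EuclideanSpace ℝ (Fin 3) | 7 / 4 < ‖w‖} := isOpen_lt continuous_const continuous_norm
  filter_upwards [ho.mem_nhds hy] with w hw
  rw [gradient_kwonCutoff_eq_zero_of_gt hw, smul_zero, ← crossCLM_apply, map_zero, sub_zero]

/-- The derivative of the adjoint field vanishes for `|y| > 7/4`. [folklore] -/
private theorem fderiv_adjointField_eq_zero {x c y : EuclideanSpace ℝ (Fin 3)} (hy : 7 / 4 < ‖y‖) :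
    fderiv ℝ (fun y : EuclideanSpace ℝ (Fin 3) =>
      ⟪gradient annularKernel (x - y), c⟫ • gradient kwonCutoff y -
        cross (cross c (gradient annularKernel (x - y))) (gradient kwonCutoff y)) y = 0 := by
  rw [(adjointField_eventuallyEq_zero hy).fderiv_eq, fderiv_fun_const, Pi.zero_apply]

/-- The Laplacian of the adjoint field vanishes for `|y| > 7/4`. [folklore] -/
private theorem laplacian_adjointField_eq_zero {x c y : EuclideanSpace ℝ (Fin 3)} (hy : 7 / 4 < ‖y‖) :
    Δ (fun y : EuclideanSpace ℝ (Fin 3) =>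
      ⟪gradient annularKernel (x - y), c⟫ • gradient kwonCutoff y -
        cross (cross c (gradient annularKernel (x - y))) (gradient kwonCutoff y)) y = 0 := by
  rw [(laplacian_congr_nhds (adjointField_eventuallyEq_zero hy)).self_of_nhds,
    laplacian_eq_iteratedFDeriv_stdOrthonormalBasis]
  simp

/-- The divergence of the adjoint field vanishes for `|y| > 7/4`. [folklore] -/
private theorem divergence_adjointField_eq_zero {x c y : EuclideanSpace ℝ (Fin 3)} (hy : 7 / 4 < ‖y‖) :
    VectorCalculus.divergence (fun y : EuclideanSpace ℝ (Fin 3) =>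
      ⟪gradient annularKernel (x - y), c⟫ • gradient kwonCutoff y -
        cross (cross c (gradient annularKernel (x - y))) (gradient kwonCutoff y)) y = 0 := by
  simp only [VectorCalculus.divergence]
  rw [fderiv_adjointField_eq_zero hy]
  simp

/-- The Laplacian of a smooth field is continuous. [folklore] -/
private theorem continuous_laplacian_of_contDiff {η : EuclideanSpace ℝ (Fin 3) → EuclideanSpace ℝ (Fin 3)}
    (hη : ContDiff ℝ ∞ η) : Continuous (Δ η) := by
  rw [laplacian_eq_iteratedFDeriv_stdOrthonormalBasis]
  refine continuous_finsetSum _ fun i _ => ?_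
  exact (ContinuousMultilinearMap.apply ℝ (fun _ : Fin 2 => EuclideanSpace ℝ (Fin 3)) (EuclideanSpace ℝ (Fin 3))
    _).continuous.comp ((contDiff_infty.1 hη 2).continuous_iteratedFDeriv (m := 2) le_rfl)

/-! ### Transport of the tested identity to the representative `W` -/

/-- If `W = 1_O u` a.e., then `W = u` a.e. on `O`. [folklore] -/
private theorem ae_restrict_eq_of_ae_eq_indicator' {O : Set (ℝ × EuclideanSpace ℝ (Fin 3))}
    (hO : MeasurableSet O) (hWu : uncurry W =ᵐ[volume] O.indicator (uncurry u)) :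
    ∀ᵐ z ∂(volume.restrict O), W z.1 z.2 = u z.1 z.2 := by
  filter_upwards [ae_restrict_mem hO, ae_restrict_of_ae hWu] with z hz h
  rw [indicator_of_mem hz] at h
  exact h

/-- **The momentum equation tested with `χ(s) η_{x,c}(y)`, written for the good representative**
`W` (`W = u` a.e. on `Q₂(0)`). [cite: Kwon2023RolePressure, Lemma 2.5 (proof, p. 8–9) with Remark 2.3] -/
theorem ns_tested_time_smul_adjointField_repr
    (hu : IsDistributionalNSSolutionOn (parabolicCylinderOpens 2 (0 : ℝ × EuclideanSpace ℝ (Fin 3))) 1 0 u p)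
    (hWu : uncurry W =ᵐ[volume]
      (parabolicCylinder 2 (0 : ℝ × EuclideanSpace ℝ (Fin 3))).indicator (uncurry u))
    {χ : ℝ → ℝ} (hχ : ContDiff ℝ ∞ χ) (hχc : HasCompactSupport χ) (hχI : tsupport χ ⊆ Ioo (-4 : ℝ) 0)
    (x c : EuclideanSpace ℝ (Fin 3)) :
    ∫ z in parabolicCylinder 2 (0 : ℝ × EuclideanSpace ℝ (Fin 3)),
      (deriv χ z.1 * ⟪W z.1 z.2, ⟪gradient annularKernel (x - z.2), c⟫ • gradient kwonCutoff z.2 -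
          cross (cross c (gradient annularKernel (x - z.2))) (gradient kwonCutoff z.2)⟫ +
        χ z.1 * (⟪W z.1 z.2, fderiv ℝ (fun y => ⟪gradient annularKernel (x - y), c⟫ • gradient kwonCutoff y -
            cross (cross c (gradient annularKernel (x - y))) (gradient kwonCutoff y)) z.2 (W z.1 z.2)⟫ +
          ⟪W z.1 z.2, Δ (fun y => ⟪gradient annularKernel (x - y), c⟫ • gradient kwonCutoff y -
            cross (cross c (gradient annularKernel (x - y))) (gradient kwonCutoff y)) z.2⟫ +
          p z.1 z.2 * VectorCalculus.divergence (fun y => ⟪gradient annularKernel (x - y), c⟫ • gradient kwonCutoff y -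
            cross (cross c (gradient annularKernel (x - y))) (gradient kwonCutoff y)) z.2)) = 0 := by
  have hQ : MeasurableSet (parabolicCylinder 2 (0 : ℝ × EuclideanSpace ℝ (Fin 3))) :=
    (isOpen_parabolicCylinder 2 _).measurableSet
  refine (setIntegral_congr_ae hQ ?_).trans (ns_tested_time_smul_adjointField hu hχ hχc hχI x c)
  filter_upwards [(ae_restrict_iff' hQ).1 (ae_restrict_eq_of_ae_eq_indicator' hQ hWu)] with z hz hzO
  rw [hz hzO]

/-! ### Integrability of the four space–time integrands -/

/-- `z ↦ ⟪a(z), L(z) a(z)⟫` is integrable when `|a|²` is locally integrable and the continuous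
operator field `L` is supported in a compact set (`|⟪a, L a⟫| ≤ ‖L‖ |a|²`). [folklore] -/
private theorem integrable_inner_clm_apply_self_loc
    {a : ℝ × EuclideanSpace ℝ (Fin 3) → EuclideanSpace ℝ (Fin 3)}
    (ham : AEStronglyMeasurable a volume)
    (ha : LocallyIntegrable (fun z => ‖a z‖ ^ 2) volume)
    {L : ℝ × EuclideanSpace ℝ (Fin 3) → EuclideanSpace ℝ (Fin 3) →L[ℝ] EuclideanSpace ℝ (Fin 3)}
    (hL : Continuous L) {K : Set (ℝ × EuclideanSpace ℝ (Fin 3))} (hK : IsCompact K)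
    (hLK : ∀ z ∉ K, L z = 0) :
    Integrable (fun z => ⟪a z, L z (a z)⟫) (volume : Measure (ℝ × EuclideanSpace ℝ (Fin 3))) := by
  have haK : IntegrableOn (fun z => ‖a z‖ ^ 2) K volume := ha.integrableOn_isCompact hK
  have hLc : HasCompactSupport L := HasCompactSupport.intro hK hLK
  obtain ⟨C, hC⟩ := hL.bounded_above_of_compact_support hLc
  have hsupp : support (fun z => ⟪a z, L z (a z)⟫) ⊆ K := by
    intro z hz
    by_contra hzK
    exact hz (by simp [hLK z hzK])
  refine (integrableOn_iff_integrable_of_support_subset hsupp).1 ?_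
  refine Integrable.mono' (haK.mul_const C)
    (ham.inner (isBoundedBilinearMap_apply.continuous.comp_aestronglyMeasurable
      (hL.aestronglyMeasurable.prodMk ham))).restrict ?_
  filter_upwards with z
  have h0 : 0 ≤ C := (norm_nonneg _).trans (hC z)
  calc ‖⟪a z, L z (a z)⟫‖ ≤ ‖a z‖ * ‖L z (a z)‖ := norm_inner_le_norm _ _
    _ ≤ ‖a z‖ * (C * ‖a z‖) := by
        refine mul_le_mul_of_nonneg_left ((le_opNorm _ _).trans ?_) (norm_nonneg _)
        exact mul_le_mul_of_nonneg_right (hC z) (norm_nonneg _)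
    _ = ‖a z‖ ^ 2 * C := by ring

/-- `Q₂(0) = (−4, 0) × B₂`. [folklore] -/
private theorem parabolicCylinder_two_zero' :
    parabolicCylinder 2 (0 : ℝ × EuclideanSpace ℝ (Fin 3)) =
      Ioo (-4 : ℝ) 0 ×ˢ ball (0 : EuclideanSpace ℝ (Fin 3)) 2 := by
  rw [parabolicCylinder]
  norm_num

/-! ### The weak time derivative of `t ↦ ⟪h(t,x), c⟫` -/

/-- **The weak time derivative of Kwon's drift.** For a distributional Navier–Stokes solution
`(u, p)` on `Q₂(0)` (`ν = 1`, `f = 0`), its good representative `W` and `h = driftField W`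
(`h(t,·) = H(W(t,·))`): for every `x`, `c` and `χ ∈ C_c^∞((−4,0))`,
`∫ χ'(s)⟪h(s,x), c⟫ ds = −∫ χ(s) ∫ (⟪W,(W·∇)η_{x,c}⟫ + ⟪W, Δη_{x,c}⟫ + p div η_{x,c})(s,y) dy ds`
with the adjoint field `η_{x,c}(y) = ⟪∇k(x − y), c⟫ ∇φ(y) − (c × ∇k(x − y)) × ∇φ(y)` — `t ↦ h(t,x)`
is weakly differentiable in time with derivative given by the Navier–Stokes equations tested
against the kernel of `H` (the time-regularity of the drift in the proof of Lemma 2.5).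
[cite: Kwon2023RolePressure, Lemma 2.5 (proof, p. 8–9) with Remark 2.3 (2.3)] -/
theorem integral_deriv_mul_inner_driftField_eq (hW : IsGoodVelocity W)
    (hu : IsDistributionalNSSolutionOn (parabolicCylinderOpens 2 (0 : ℝ × EuclideanSpace ℝ (Fin 3))) 1 0 u p)
    (hWu : uncurry W =ᵐ[volume]
      (parabolicCylinder 2 (0 : ℝ × EuclideanSpace ℝ (Fin 3))).indicator (uncurry u))
    {χ : ℝ → ℝ} (hχ : ContDiff ℝ ∞ χ) (hχc : HasCompactSupport χ) (hχI : tsupport χ ⊆ Ioo (-4 : ℝ) 0)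
    (x c : EuclideanSpace ℝ (Fin 3)) :
    ∫ s, deriv χ s * ⟪driftField W s x, c⟫ =
      -∫ s, χ s * ∫ y, (⟪W s y, fderiv ℝ (fun y => ⟪gradient annularKernel (x - y), c⟫ • gradient kwonCutoff y -
            cross (cross c (gradient annularKernel (x - y))) (gradient kwonCutoff y)) y (W s y)⟫ +
          ⟪W s y, Δ (fun y => ⟪gradient annularKernel (x - y), c⟫ • gradient kwonCutoff y -
            cross (cross c (gradient annularKernel (x - y))) (gradient kwonCutoff y)) y⟫ +
          p s y * VectorCalculus.divergence (fun y => ⟪gradient annularKernel (x - y), c⟫ • gradient kwonCutoff y -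
            cross (cross c (gradient annularKernel (x - y))) (gradient kwonCutoff y)) y) := by
  set η : EuclideanSpace ℝ (Fin 3) → EuclideanSpace ℝ (Fin 3) := fun y =>
    ⟪gradient annularKernel (x - y), c⟫ • gradient kwonCutoff y -
      cross (cross c (gradient annularKernel (x - y))) (gradient kwonCutoff y) with hηdef
  -- smoothness, support and continuity of the fields built from `η` and `χ`
  have hη : ContDiff ℝ ∞ η := contDiff_adjointField' x c
  have hηc : Continuous η := hη.continuous
  have hDηc : Continuous (fderiv ℝ η) := hη.continuous_fderiv (by simp)
  have hΔηc : Continuous (Δ η) := continuous_laplacian_of_contDiff hη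
  have hdivc : Continuous (VectorCalculus.divergence η) := (contDiff_divergence_of_contDiff_top hη).continuous
  have hη0 : ∀ y : EuclideanSpace ℝ (Fin 3), 7 / 4 < ‖y‖ → η y = 0 := fun y hy =>
    (adjointField_eventuallyEq_zero (x := x) (c := c) hy).self_of_nhds
  have hDη0 : ∀ y : EuclideanSpace ℝ (Fin 3), 7 / 4 < ‖y‖ → fderiv ℝ η y = 0 := fun y hy =>
    fderiv_adjointField_eq_zero hy
  have hΔη0 : ∀ y : EuclideanSpace ℝ (Fin 3), 7 / 4 < ‖y‖ → Δ η y = 0 := fun y hy =>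
    laplacian_adjointField_eq_zero hy
  have hdiv0 : ∀ y : EuclideanSpace ℝ (Fin 3), 7 / 4 < ‖y‖ → VectorCalculus.divergence η y = 0 :=
    fun y hy => divergence_adjointField_eq_zero hy
  have hχcont : Continuous χ := hχ.continuous
  have hχ'cont : Continuous (deriv χ) := hχ.continuous_deriv (by simp)
  have hχ0 : ∀ s, s ∉ tsupport χ → χ s = 0 := fun s hs => image_eq_zero_of_notMem_tsupport hs
  have hχ'0 : ∀ s, s ∉ tsupport χ → deriv χ s = 0 := fun s hs =>
    notMem_support.1 fun h => hs (support_deriv_subset h)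
  -- the compact `K = supp χ × B̄_{7/4} ⊆ Q₂(0)` carrying all integrands
  set K : Set (ℝ × EuclideanSpace ℝ (Fin 3)) := tsupport χ ×ˢ closedBall (0 : EuclideanSpace ℝ (Fin 3)) (7 / 4)
    with hK
  have hKc : IsCompact K := hχc.prod (isCompact_closedBall 0 (7 / 4))
  have hKQ : K ⊆ parabolicCylinder 2 (0 : ℝ × EuclideanSpace ℝ (Fin 3)) := by
    rw [parabolicCylinder_two_zero']
    exact prod_mono hχI (closedBall_subset_ball (by norm_num))
  have hKout : ∀ z : ℝ × EuclideanSpace ℝ (Fin 3), z ∉ K → z.1 ∉ tsupport χ ∨ 7 / 4 < ‖z.2‖ := by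
    intro z hz
    rcases not_and_or.1 (fun h' => hz (mem_prod.2 h')) with h1 | h1
    · exact Or.inl h1
    · right; rwa [mem_closedBall_zero_iff, not_le] at h1
  -- the four integrands
  have hWm : AEStronglyMeasurable (uncurry W) volume := hW.stronglyMeasurable.aestronglyMeasurable
  have hA : Integrable (fun z : ℝ × EuclideanSpace ℝ (Fin 3) => ⟪W z.1 z.2, deriv χ z.1 • η z.2⟫) := by
    refine integrable_inner_of_locallyIntegrableOn (Q := ⊤) (hW.locallyIntegrable.locallyIntegrableOn _)
      ((hχ'cont.comp continuous_fst).smul (hηc.comp continuous_snd)) hKc (subset_univ _) fun z hz => ?_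
    rcases hKout z hz with h | h
    · rw [hχ'0 _ h, zero_smul]
    · rw [hη0 _ h, smul_zero]
  have hB : Integrable (fun z : ℝ × EuclideanSpace ℝ (Fin 3) =>
      ⟪W z.1 z.2, (χ z.1 • fderiv ℝ η z.2) (W z.1 z.2)⟫) := by
    refine integrable_inner_clm_apply_self_loc (a := uncurry W) hWm hW.locallyIntegrable_sq
      ((hχcont.comp continuous_fst).smul (hDηc.comp continuous_snd)) hKc fun z hz => ?_
    rcases hKout z hz with h | h
    · ext v; simp [hχ0 _ h]
    · ext v; simp [hDη0 _ h]
  have hC : Integrable (fun z : ℝ × EuclideanSpace ℝ (Fin 3) => ⟪W z.1 z.2, χ z.1 • Δ η z.2⟫) := by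
    refine integrable_inner_of_locallyIntegrableOn (Q := ⊤) (hW.locallyIntegrable.locallyIntegrableOn _)
      ((hχcont.comp continuous_fst).smul (hΔηc.comp continuous_snd)) hKc (subset_univ _) fun z hz => ?_
    rcases hKout z hz with h | h
    · rw [hχ0 _ h, zero_smul]
    · rw [hΔη0 _ h, smul_zero]
  have hD : Integrable (fun z : ℝ × EuclideanSpace ℝ (Fin 3) =>
      uncurry p z * (χ z.1 * VectorCalculus.divergence η z.2)) := by
    have hpli : LocallyIntegrableOn (uncurry p)
        ((parabolicCylinderOpens 2 (0 : ℝ × EuclideanSpace ℝ (Fin 3))) : Set (ℝ × EuclideanSpace ℝ (Fin 3)))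
        volume := hu.2.2.1
    refine integrable_mul_of_locallyIntegrableOn hpli
      ((hχcont.comp continuous_fst).mul (hdivc.comp continuous_snd)) hKc
      (by rw [coe_parabolicCylinderOpens]; exact hKQ) fun z hz => ?_
    rcases hKout z hz with h | h
    · rw [hχ0 _ h, zero_mul]
    · rw [hdiv0 _ h, mul_zero]
  -- the total integrand
  set F : ℝ × EuclideanSpace ℝ (Fin 3) → ℝ := fun z =>
    deriv χ z.1 * ⟪W z.1 z.2, η z.2⟫ +
      χ z.1 * (⟪W z.1 z.2, fderiv ℝ η z.2 (W z.1 z.2)⟫ + ⟪W z.1 z.2, Δ η z.2⟫ +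
        p z.1 z.2 * VectorCalculus.divergence η z.2) with hFdef
  have eF : ∀ z, F z = ⟪W z.1 z.2, deriv χ z.1 • η z.2⟫ +
      (⟪W z.1 z.2, (χ z.1 • fderiv ℝ η z.2) (W z.1 z.2)⟫ + ⟪W z.1 z.2, χ z.1 • Δ η z.2⟫ +
        uncurry p z * (χ z.1 * VectorCalculus.divergence η z.2)) := by
    intro z
    simp only [hFdef, _root_.smul_apply, inner_smul_right, uncurry]
    ring
  have hBCD : Integrable (fun z : ℝ × EuclideanSpace ℝ (Fin 3) =>
      ⟪W z.1 z.2, (χ z.1 • fderiv ℝ η z.2) (W z.1 z.2)⟫ + ⟪W z.1 z.2, χ z.1 • Δ η z.2⟫ +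
        uncurry p z * (χ z.1 * VectorCalculus.divergence η z.2)) := (hB.add hC).add hD
  have hF : Integrable F := by
    rw [show F = fun z => ⟪W z.1 z.2, deriv χ z.1 • η z.2⟫ +
      (⟪W z.1 z.2, (χ z.1 • fderiv ℝ η z.2) (W z.1 z.2)⟫ + ⟪W z.1 z.2, χ z.1 • Δ η z.2⟫ +
        uncurry p z * (χ z.1 * VectorCalculus.divergence η z.2)) from funext eF]
    exact hA.add hBCD
  -- the tested identity over `Q₂(0)`, rewritten over `ℝ × ℝ³` and split by Fubini
  have key : ∫ z in parabolicCylinder 2 (0 : ℝ × EuclideanSpace ℝ (Fin 3)), F z = 0 :=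
    ns_tested_time_smul_adjointField_repr hu hWu hχ hχc hχI x c
  have hF0 : ∀ z, z ∉ parabolicCylinder 2 (0 : ℝ × EuclideanSpace ℝ (Fin 3)) → F z = 0 := by
    intro z hz
    rcases hKout z (fun h => hz (hKQ h)) with h | h
    · simp only [hFdef, hχ0 _ h, hχ'0 _ h, zero_mul, add_zero]
    · simp [hFdef, hη0 _ h, hDη0 _ h, hΔη0 _ h, hdiv0 _ h]
  rw [setIntegral_eq_integral_of_forall_compl_eq_zero hF0,
    show (volume : Measure (ℝ × EuclideanSpace ℝ (Fin 3))) = (volume : Measure ℝ).prod volume from rfl,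
    integral_prod F hF] at key
  -- the slices
  have hsA : ∀ s, ∫ y, ⟪W s y, deriv χ s • η y⟫ = deriv χ s * ⟪driftField W s x, c⟫ := by
    intro s
    simp_rw [real_inner_smul_right]
    rw [integral_const_mul, driftField, inner_harmonicPart_eq_integral (hW.integrable s).integrableOn x c]
  have hsBCD : ∀ s, ∫ y, (⟪W s y, (χ s • fderiv ℝ η y) (W s y)⟫ + ⟪W s y, χ s • Δ η y⟫ +
      uncurry p (s, y) * (χ s * VectorCalculus.divergence η y)) =
      χ s * ∫ y, (⟪W s y, fderiv ℝ η y (W s y)⟫ + ⟪W s y, Δ η y⟫ + p s y * VectorCalculus.divergence η y) := by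
    intro s
    rw [← integral_const_mul]
    refine integral_congr_ae (Eventually.of_forall fun y => ?_)
    simp only [_root_.smul_apply, inner_smul_right, uncurry]
    ring
  have hAs : ∀ s, Integrable fun y => ⟪W s y, deriv χ s • η y⟫ := by
    intro s
    obtain ⟨M, hM⟩ := (hηc.norm).bddAbove_range_of_hasCompactSupport
      ((HasCompactSupport.intro (isCompact_closedBall (0 : EuclideanSpace ℝ (Fin 3)) (7 / 4))
        fun y hy => hη0 y (by rwa [mem_closedBall_zero_iff, not_le] at hy)).norm)
    refine ((hW.integrable s).norm.mul_const (‖deriv χ s‖ * M)).mono'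
      ((hW.aestronglyMeasurable_slice s).inner
        ((continuous_const (y := deriv χ s)).smul hηc : Continuous fun y => deriv χ s • η y).aestronglyMeasurable)
      (Eventually.of_forall fun y => ?_)
    calc ‖⟪W s y, deriv χ s • η y⟫‖ ≤ ‖W s y‖ * ‖deriv χ s • η y‖ := norm_inner_le_norm _ _
      _ = ‖W s y‖ * (‖deriv χ s‖ * ‖η y‖) := by rw [norm_smul]
      _ ≤ ‖W s y‖ * (‖deriv χ s‖ * M) := by
          gcongr
          exact hM (mem_range_self y)
  have hslice : ∀ᵐ s ∂(volume : Measure ℝ), ∫ y, F (s, y) =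
      deriv χ s * ⟪driftField W s x, c⟫ +
        χ s * ∫ y, (⟪W s y, fderiv ℝ η y (W s y)⟫ + ⟪W s y, Δ η y⟫ + p s y * VectorCalculus.divergence η y) := by
    filter_upwards [hBCD.prod_right_ae] with s hs
    rw [← hsA s, ← hsBCD s, ← integral_add (hAs s) hs]
    exact integral_congr_ae (Eventually.of_forall fun y => eF (s, y))
  rw [integral_congr_ae hslice, integral_add] at key
  · linarith
  · refine (hA.integral_prod_left).congr (Eventually.of_forall fun s => ?_)
    exact hsA s
  · refine (hBCD.integral_prod_left).congr (Eventually.of_forall fun s => ?_)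
    exact hsBCD s

end Kwon2023

end Literature.Analysis.FluidPDE

end
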